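import Literature.AnabelianGeometry.AbsoluteAnabelian.AbsTopIProp23iAlmostProSigmaModel
import Literature.AnabelianGeometry.SemiGraphs.ProSigmaPuncturedSurfaceElastic
import HarnessLib

/-!
# [AbsTopI] Prop 2.3 (i) at the ALMOST pro-`Σ` surface-group model — every hyperbolic type `(g, r)`

Companion of `AbsTopIProp23iAlmostProSigmaModel.lean` (closed class `r = 0`): the same ascent over abc-iut-w5-d206's
punctured-class model `slim_and_elastic_of_isProSigmaCompletion_puncturedSurfaceGroup` (`r ≥ 1`), assembled by cases on
`r` into ONE statement indexed by `PuncturedSurfaceGroup.IsHyperbolicType g r` (`2 < 2g + r`).  S. Mochizuki, [AbsTopI]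
Prop 2.3 (i) p. 19 ("`Δ` is slim and elastic" for `Δ` of GFG-type, hence almost pro-`Σ` by Def 2.1 (i) p. 17).
PROOF-ONLY; no definition; nothing restated.  HONEST SCOPE as in the companion: the input «`Δ` has no nontrivial finite
normal subgroup» is necessary and geometric; orbicurves and `char k ∈ Σ` remain outside the surface-group model.
Classical; nothing here bears on [IUTchIII] Cor. 3.12.
-/

noncomputable section

open Topology

universe u

namespace Literature.AnabelianGeometry.AbsoluteAnabelian

open Literature.AlgebraicGeometry.Frobenioids (IsSlimGroup)
open Literature.AnabelianGeometry.SemiGraphs.SemiGraphOfAnabelioids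
open Literature.GroupTheory.CombinatorialGroupTheory

variable {G : Type u} [Group G] [TopologicalSpace G] [IsTopologicalGroup G] [CompactSpace G] [T2Space G]
  [TotallyDisconnectedSpace G]

/-- **Prop 2.3 (i), almost pro-`Σ` model, every hyperbolic type**: a profinite `G` with no nontrivial finite normal
subgroup containing an OPEN subgroup `U` that is a pro-`Σ` completion of a surface group `Γ_{g,r}` of hyperbolic type
(`2g − 2 + r > 0`; `Σ` a nonempty set of primes) is slim and elastic. [cite: MochizukiAbsTopI2012, Prop 2.3 (i) p.19] -/
theorem slim_and_elastic_of_isOpen_proSigma_hyperbolic {Sigma : Set ℕ} (hS : Sigma.Nonempty)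
    (hSp : ∀ p ∈ Sigma, p.Prime) {g r : ℕ} (hgr : PuncturedSurfaceGroup.IsHyperbolicType g r)
    (U : Subgroup G) (hUo : IsOpen (U : Set G)) (ι : PuncturedSurfaceGroup g r →* U)
    (hι : IsProSigmaCompletion Sigma ι) (hfin : ∀ N : Subgroup G, N.Normal → (N : Set G).Finite → N = ⊥) :
    IsSlimGroup G ∧ IsElastic G := by
  haveI : CompactSpace U := isCompact_iff_compactSpace.mp (Subgroup.isClosed_of_isOpen U hUo).isCompact
  rcases Nat.eq_zero_or_pos r with hr | hr
  · subst hr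
    have hg : 2 ≤ g := by
      unfold PuncturedSurfaceGroup.IsHyperbolicType at hgr
      omega
    exact slim_and_elastic_of_isOpen_proSigma_closedSurfaceGroup hS hSp hg U hUo ι hι hfin
  · obtain ⟨ℓ, hℓ⟩ := hS
    have hU := slim_and_elastic_of_isProSigmaCompletion_puncturedSurfaceGroup hr hgr hι ⟨ℓ, hℓ, hSp ℓ hℓ⟩
    exact slim_and_elastic_of_isOpen U hUo hU.1 hU.2 hfin

namespace FundamentalExtension

/-- **`E.GeomSlimElastic` at the almost pro-`Σ` model, every hyperbolic type** (the node predicate of [AbsTopI]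
Prop 2.3 (i) for `Δ = E.geom` with an open pro-`Σ` hyperbolic surface-group subgroup, given no nontrivial finite
normal subgroup of `Δ`). [cite: MochizukiAbsTopI2012, Prop 2.3 (i) p.19] -/
theorem geomSlimElastic_of_isOpen_proSigma_hyperbolic (E : FundamentalExtension.{u}) {Sigma : Set ℕ}
    (hS : Sigma.Nonempty) (hSp : ∀ p ∈ Sigma, p.Prime) {g r : ℕ} (hgr : PuncturedSurfaceGroup.IsHyperbolicType g r)
    (U : Subgroup E.geom) (hUo : IsOpen (U : Set E.geom)) (ι : PuncturedSurfaceGroup g r →* U)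
    (hι : IsProSigmaCompletion Sigma ι)
    (hfin : ∀ N : Subgroup E.geom, N.Normal → (N : Set E.geom).Finite → N = ⊥) : E.GeomSlimElastic := by
  haveI : CompactSpace E.geom := isCompact_iff_compactSpace.mp E.isClosed_geom.isCompact
  exact slim_and_elastic_of_isOpen_proSigma_hyperbolic hS hSp hgr U hUo ι hι hfin

end FundamentalExtension

end Literature.AnabelianGeometry.AbsoluteAnabelian

end
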